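import Mathlib
import Summits.Schanuel.Schanuel.Theorems.RigidCoreSchanuelOnLogFreeCorePiExpOfRe

/-!
# Line `sector-split` (v19) of crux `RigidCore.SchanuelOnLogFreeCore`: the rank-2 cells through `ℚ*·π√d`

Crux `stmt-Schanuel-0970` (`Summit.Schanuel.Schanuel.Theses.RigidCore.SchanuelOnLogFreeCore`, (R):
Schanuel's conjecture for `ℚ`-free tuples from the log-free core `C_EA`), line `sector-split`,
skeleton v19 (lead c10).  This file proves the calibration stub C11

* `stub_cruxCell_through_pi_sqrt` — GIVEN Nesterenko's corollary at every imaginary-axis CM point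
  (`π ⊥ e^{π√d}` for all `d ≥ 1`; stub C9 `stub_nesterenkoImagAxis` of the line, taken here as an
  explicit HYPOTHESIS `hN` and proved in another file), every pair `x : Fin 2 → ℂ` whose first
  coordinate is a nonzero rational multiple of `π√d` (`x 0 = r·π√d`, `r ∈ ℚ*`, `d ≥ 1`) satisfies
  the conclusion of (R), indeed of Schanuel's conjecture, with no core and no linear-independence
  hypothesis: `2 ≤ trdeg_ℚ ℚ(x 0, x 1, e^{x 0}, e^{x 1})`.

It generalises the disprover's `rank_two_through_pi` (`d = 1`: the pairs through `π`, from
`π ⊥ e^π`) and the sibling crux's `schanuelTwo_of_pi_mul_sqrt_three_mem_span` (`d = 3`), where the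
hypothesis is a PROVED tree theorem (`nesterenko_holds`, `nesterenko'_holds`).

Proof (the plane bookkeeping of `Theorems/RoyCriterionSchanuelTwoStubNesterenkoPlanes.lean`).  More
generally let the `ℚ`-plane `span_ℚ(x)` contain `c = π√d`
(`ThroughPiSqrt.schanuelTwo_of_pi_mul_sqrt_mem_span`; for the stub `c = r⁻¹ • x 0`).  Then
`c ∈ K_x = ℚ(x, e^x)` and `e^{c}` is algebraic over `K_x` (`mem_SF_and_isAlgebraic_exp_of_mem_span`:
`N c ∈ span_ℤ(x)` for a denominator `N ≥ 1`, so `(e^{c})^N ∈ K_x`); `π` is a root of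
`d X² − c² ∈ K_x[X]`, a nonzero polynomial since `d ≠ 0`; and two algebraically independent numbers
(`π`, `e^{c}`, by `hN`) algebraic over `K_x` force `trdeg_ℚ K_x ≥ 2`
(`two_le_trdeg_SF_of_isAlgebraic_pair`).

NOT here: the hypothesis `hN` itself (stub C9, the lead's file), the cells `(πi, u)` with
`Re u ∈ ℚ*·π√d` (stub C10), the two residues of the line (open problems, items stmt-Schanuel-9545 /
stmt-Schanuel-9548).

## References

* [NesterenkoPhilippon2001] Yu. V. Nesterenko, P. Philippon (eds.), *Introduction to Algebraic
  Independence Theory*, LNM 1752 (2001): Ch. 1 §3 Corollary 3.2 (PDF p. 19) — `π` and `e^{π√d}`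
  are algebraically independent for every positive integer `d`; Ch. 3 §1 Corollary 1.2 (`d = 1`).
-/

noncomputable section

-- `Summit.Schanuel.Schanuel.…` is the D-0017 single-problem layout
set_option linter.dupNamespace false

namespace Summit.Schanuel.Schanuel.Theorems.RigidCore

open IntermediateField

namespace ThroughPiSqrt

/-! ## Helpers -/

/-- `π` is algebraic over every field `F ≤ ℂ` containing `π√d`, `d ≥ 1`: it is a root of the
nonzero polynomial `d X² − (π√d)² ∈ F[X]`. [folklore] -/
theorem isAlgebraic_pi_of_pi_mul_sqrt_mem {F : IntermediateField ℚ ℂ} {d : ℕ} (hd : d ≠ 0)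
    (hc : ((Real.pi * Real.sqrt d : ℝ) : ℂ) ∈ F) : IsAlgebraic F (Real.pi : ℂ) := by
  refine ⟨Polynomial.C (d : F) * Polynomial.X ^ 2 - Polynomial.C (⟨_, hc⟩ ^ 2), ?_, ?_⟩
  · intro h0
    have h2 := congrArg (fun p => Polynomial.coeff p 2) h0
    simp only [Polynomial.coeff_sub, Polynomial.coeff_C_mul, Polynomial.coeff_X_pow, if_true,
      mul_one, Polynomial.coeff_C, OfNat.ofNat_ne_zero, if_false, sub_zero,
      Polynomial.coeff_zero, Nat.cast_eq_zero] at h2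
    exact hd h2
  · simp only [map_sub, map_mul, map_pow, Polynomial.aeval_X, Polynomial.aeval_C, map_natCast]
    simp only [IntermediateField.algebraMap_apply]
    push_cast
    rw [mul_pow, ← Complex.ofReal_pow (Real.sqrt d), Real.sq_sqrt (Nat.cast_nonneg d)]
    push_cast
    ring

/-- If a coordinate of `x` is `r · c` with `r ∈ ℚ*`, then `c = r⁻¹ • x i` lies in the `ℚ`-plane
`span_ℚ(x)`. [folklore] -/
theorem mem_span_of_apply_eq_rat_mul {n : ℕ} {x : Fin n → ℂ} {i : Fin n} {r : ℚ} {c : ℂ}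
    (hr : r ≠ 0) (h : x i = (r : ℂ) * c) : c ∈ Submodule.span ℚ (Set.range x) := by
  have hx : x i ∈ Submodule.span ℚ (Set.range x) := Submodule.subset_span ⟨i, rfl⟩
  have hc : c = r⁻¹ • x i := by
    rw [h, Rat.smul_def, Rat.cast_inv, ← mul_assoc,
      inv_mul_cancel₀ (Rat.cast_ne_zero.mpr hr : (r : ℂ) ≠ 0), one_mul]
  rw [hc]
  exact Submodule.smul_mem _ _ hx

/-- **Every `ℚ`-plane through `π√d` satisfies the crux, given `π ⊥ e^{π√d}`** (`d ≥ 1`): if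
`π√d ∈ span_ℚ(x)` then `2 ≤ trdeg_ℚ ℚ(x, e^x)` — `π` is a root of `d X² − (π√d)²` over
`K_x = ℚ(x, e^x)`, `e^{π√d}` is algebraic over `K_x`, and the two are algebraically independent by
hypothesis (Nesterenko 1996 at `τ = i√d`).  For `d = 1, 3` the hypothesis is the tree's
`algebraicIndependent_pi_exp_pi` / `algebraicIndependent_pi_exp_pi_mul_sqrt_three` and the
statement is `schanuelTwo_of_pi_mem_span` / `schanuelTwo_of_pi_mul_sqrt_three_mem_span`.
[cite: NesterenkoPhilippon2001, Ch. 1 §3 Corollary 3.2 (PDF p. 19)] -/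
theorem schanuelTwo_of_pi_mul_sqrt_mem_span {d : ℕ} (hd : d ≠ 0)
    (hN : AlgebraicIndependent ℚ ![(Real.pi : ℂ), Complex.exp ((Real.pi * Real.sqrt d : ℝ) : ℂ)])
    (x : Fin 2 → ℂ) (h : ((Real.pi * Real.sqrt d : ℝ) : ℂ) ∈ Submodule.span ℚ (Set.range x)) :
    (2 : Cardinal) ≤ Algebra.trdeg ℚ
      ↥(IntermediateField.adjoin ℚ (Set.range x ∪ Set.range (Complex.exp ∘ x))) := by
  obtain ⟨hmem, halg⟩ := mem_SF_and_isAlgebraic_exp_of_mem_span x h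
  exact two_le_trdeg_SF_of_isAlgebraic_pair x hN (isAlgebraic_pi_of_pi_mul_sqrt_mem hd hmem) halg

end ThroughPiSqrt

open ThroughPiSqrt

/-! ## Stub C11: the rank-2 cells through a point of `ℚ*·π√d` -/

/-- **Stub `stub_cruxCell_through_pi_sqrt` of line `sector-split` (v19, C11; registered
signature).**  Assume Nesterenko's corollary at every imaginary-axis CM point: `π` and `e^{π√d}`
are algebraically independent over `ℚ` for every `d ≥ 1` (stub C9 of the line, hypothesis `hN`).
Then for every `d ≥ 1`, every nonzero rational `r` and every `x : Fin 2 → ℂ` with `x 0 = r·π√d`,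
`2 ≤ trdeg_ℚ ℚ(x 0, x 1, e^{x 0}, e^{x 1})` — the conclusion of (R) (and of Schanuel's conjecture) at
`x`, with no core and no linear-independence hypothesis: `π√d = r⁻¹ • x 0 ∈ span_ℚ(x)`, and every
`ℚ`-plane through `π√d` is settled by `ThroughPiSqrt.schanuelTwo_of_pi_mul_sqrt_mem_span` (`π` is a
root of `d X² − (π√d)²` over `K_x`, `(e^{x 0})^{den r} = (e^{π√d})^{num r}` makes `e^{π√d}`
algebraic over `K_x`, and `π ⊥ e^{π√d}`).  Generalises `rank_two_through_pi` (`d = 1`).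
[cite: NesterenkoPhilippon2001, Ch. 1 §3 Corollary 3.2 (PDF p. 19)] -/
theorem stub_cruxCell_through_pi_sqrt :
    (∀ d : ℕ, d ≠ 0 →
      AlgebraicIndependent ℚ ![(Real.pi : ℂ), Complex.exp ((Real.pi * Real.sqrt d : ℝ) : ℂ)]) →
    ∀ (d : ℕ) (r : ℚ) (x : Fin 2 → ℂ), d ≠ 0 → r ≠ 0 →
      x 0 = (r : ℂ) * ((Real.pi * Real.sqrt d : ℝ) : ℂ) →
      ((2 : ℕ) : Cardinal) ≤ Algebra.trdeg ℚ
        ↥(IntermediateField.adjoin ℚ (Set.range x ∪ Set.range (Complex.exp ∘ x))) := by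
  intro hN d r x hd hr h0
  have h := schanuelTwo_of_pi_mul_sqrt_mem_span hd (hN d hd) x (mem_span_of_apply_eq_rat_mul hr h0)
  exact_mod_cast h

/-! ## Cells (the hypothesis `hN` = stub C9 kept explicit) -/

/-- The family `r = 1`: given `hN`, for every `d ≥ 1` and every `z : ℂ`, the pair `x = (π√d, z)` has
`2 ≤ trdeg_ℚ ℚ(π√d, z, e^{π√d}, e^{z})` (e.g. `(π√2, 1)`, `(π√5, e)`, `(π√7, πi)`).
[cite: NesterenkoPhilippon2001, Ch. 1 §3 Corollary 3.2 (PDF p. 19)] -/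
theorem ThroughPiSqrt.cruxCell_pi_sqrt_pair
    (hN : ∀ d : ℕ, d ≠ 0 →
      AlgebraicIndependent ℚ ![(Real.pi : ℂ), Complex.exp ((Real.pi * Real.sqrt d : ℝ) : ℂ)])
    (d : ℕ) (hd : d ≠ 0) (z : ℂ) :
    ((2 : ℕ) : Cardinal) ≤ Algebra.trdeg ℚ
      ↥(IntermediateField.adjoin ℚ
        (Set.range ![((Real.pi * Real.sqrt d : ℝ) : ℂ), z] ∪
          Set.range (Complex.exp ∘ ![((Real.pi * Real.sqrt d : ℝ) : ℂ), z]))) :=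
  stub_cruxCell_through_pi_sqrt hN d 1 _ hd one_ne_zero (by simp)

/-- Cell `(π√2, 1)`: given `hN`, `2 ≤ trdeg_ℚ ℚ(π√2, 1, e^{π√2}, e)`, i.e. `π ⊥ e^{π√2}` read as a
rank-2 instance of (R) through the point `π√2 ∈ ℚ*·π√2` (a pair on no `ℚ`-plane through `π` or
`π√3`). [cite: NesterenkoPhilippon2001, Ch. 1 §3 Corollary 3.2 (PDF p. 19)] -/
theorem ThroughPiSqrt.cruxCell_pi_sqrt_two_one
    (hN : ∀ d : ℕ, d ≠ 0 →
      AlgebraicIndependent ℚ ![(Real.pi : ℂ), Complex.exp ((Real.pi * Real.sqrt d : ℝ) : ℂ)]) :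
    ((2 : ℕ) : Cardinal) ≤ Algebra.trdeg ℚ
      ↥(IntermediateField.adjoin ℚ
        (Set.range ![((Real.pi * Real.sqrt 2 : ℝ) : ℂ), 1] ∪
          Set.range (Complex.exp ∘ ![((Real.pi * Real.sqrt 2 : ℝ) : ℂ), 1]))) :=
  cruxCell_pi_sqrt_pair hN 2 two_ne_zero 1

/-- Cell `(π√5 / 3, e)`: given `hN`, `2 ≤ trdeg_ℚ ℚ(π√5/3, e, e^{π√5/3}, e^e)` — a pair through the
point `(1/3)·π√5` of `ℚ*·π√5` (`r = 1/3`, `d = 5`).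
[cite: NesterenkoPhilippon2001, Ch. 1 §3 Corollary 3.2 (PDF p. 19)] -/
theorem ThroughPiSqrt.cruxCell_pi_sqrt_five_div_three_exp_one
    (hN : ∀ d : ℕ, d ≠ 0 →
      AlgebraicIndependent ℚ ![(Real.pi : ℂ), Complex.exp ((Real.pi * Real.sqrt d : ℝ) : ℂ)]) :
    ((2 : ℕ) : Cardinal) ≤ Algebra.trdeg ℚ
      ↥(IntermediateField.adjoin ℚ
        (Set.range ![((Real.pi * Real.sqrt 5 : ℝ) : ℂ) / 3, Complex.exp 1] ∪
          Set.range (Complex.exp ∘ ![((Real.pi * Real.sqrt 5 : ℝ) : ℂ) / 3, Complex.exp 1]))) := by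
  refine stub_cruxCell_through_pi_sqrt hN 5 (1 / 3) _ (by norm_num) (by norm_num) ?_
  simp only [Matrix.cons_val_zero]
  push_cast
  ring

end Summit.Schanuel.Schanuel.Theorems.RigidCore

end
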